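import Summits.ABC.StewartYu.ArchG3RecLinesOAtomsC
import HarnessLib

/-!
# `ArchG3Rec` — letter lines in closed form, the O-FAMILY (odd-node k-step `(lev,0) → (lev,1)`, `lev ≥ 1`): the smallness, the coefficient
# line (C) and the jets line (J) of `OddStepLinesK κ c lev`, dominated by `U0 c = cⁿ·Ω·W`

Support file (theorems only; no named facts).  Cell `abc-stewartyu` (HOME `run/shared/lean/pub/abc-stewartyu/`), route `YuMatveevShapeRat`
(rung A1.L), crux r2 `ArchCoreRat` (stmt-ABC-20502), line `arch-g3-frame`, seam (B) of the last open stub `stub_recLinesArch`, plan R50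
assignment «O (odd step): (J)+(C)+smallness → p2» (seat p2 g8).  Unit `Z = G·X·L`; p1's letter sheet `ArchG3RecLinesA–E`, p4's κ-twins
`ArchG3RecLinesCK`; every helper of this family carries the suffix `O` (no collision with the other families' files).

THE LEDGER.  In the three conjuncts proved here the only NEGATIVE letter is `−U0 c = −cⁿ·Ω·W` (inside `cbRK`, resp. `δR c = e^{−U0 c}`); every
cost atom is `≤ a·Z` with an absolute rational `a` (files `ArchG3RecLinesOAtoms/B/C`): (C) total `≤ 5.75·Z`, (J) total `≤ 8.8·Z`, so both hold
as soon as `2^{4n}·Z ≤ U0 c` (p4's ✓ `ArchG3Rec.U0_ge 4 : 2^64 ≤ c → 2^{4n}·Z ≤ U0 c`), the smallness as soon as `Z ≤ U0 c`.  Hypotheses (R50′):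
`2 ≤ n`, `Monotone P.A` (J only), `1 ≤ lev ≤ Ŝ`, `1 ≤ κ` with `log κ ≤ n·log 2` (so `κ = 2^(n−1)`), the shared global atom `cPRK κ ≤ cPz·Z` with
`cPz ≤ 9/4` (p1's letter), and the budget `hU0`.

* `oddSmall_holds` — `LbRK κ lev jl · δR c · (6·Nh lev) ≤ 1`;
* `oddC_holds` — the coefficient line (C) (`… + cbRK + cDR + log 3 < 0`);
* `oddJ_holds` — the jets line (J).

WHAT THIS IS NOT: the side conditions (p1's `side_odd`) and the far line (F) of the family (p1), the other families, the stub; no crux moves.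

## References
* [Nesterenko2003] Yu. V. Nesterenko, LNM 1819 (2003) — §4.2 (4.24)–(4.35) with the odd nodes `𝒳_{s,0}`, p. 87–90; §3.5 (3.22)–(3.25),
  Lemma 3.10 (3.35), Lemma 3.11 (3.42), (3.37).
-/

noncomputable section

open Finset Real
open scoped Nat
open Summit.ABC.StewartYu.ArchSupply (WC)
open Summit.ABC.StewartYu.ArchG3Setup (DΔC)

namespace Summit.ABC.StewartYu

namespace ArchG3Rec

open PadicG3Par (Cb Cb_pos)
open ArchG3Par (G K yloadK G_eq G_pos K_pos yloadK_pos)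

variable {n : ℕ} (P : ArchG3Rec n)

/-- **THE SMALLNESS CONJUNCT of the O-family**: `LbRK κ lev jl · δR c · (6·Nh lev) ≤ 1` for `lev ≤ Sd`, as soon as `Z ≤ U0 c`
(`log(LbRK+1) + log(6 Nh) ≤ 7 + WN + L/2^21 + Sd·log 2 + X ≤ Z`). [cite: Nesterenko2003, §4.2 (4.24); shape only] -/
theorem oddSmall_holds (hn : 2 ≤ n) (κ : ℕ) {c : ℝ} (lev : ℕ) (hlevS : lev ≤ P.Sd) (hU0 : P.Z ≤ P.U0 c) :
    (P.LbRK κ lev P.jl : ℝ) * P.δR c * (6 * P.Nh lev) ≤ 1 := by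
  obtain ⟨hlogLb, hlog6, -⟩ := P.log_box_range_leO κ lev hlevS
  obtain ⟨-, -, hLb0⟩ := P.LbRK_last_leO κ lev
  obtain ⟨hNh1, -, -, -⟩ := P.Nh_realO lev
  obtain ⟨hLZ, hXLZ, hXZ, hLWZ, hWNZ, hZ1⟩ := P.currenciesO' hn
  have hSd : (P.Sd : ℝ) * Real.log 2 ≤ P.L := by
    have h := P.Sd_real_le_L
    have hl2 : Real.log 2 < 1 := by have := Real.log_two_lt_d9; linarith
    have hS0 : (0 : ℝ) ≤ P.Sd := Nat.cast_nonneg _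
    nlinarith
  -- the logarithmic budget
  have hbud : Real.log ((P.LbRK κ lev P.jl : ℝ) + 1) + Real.log (6 * (P.Nh lev : ℝ)) ≤ P.U0 c := by
    have hL := P.L_real.1
    have : (P.L : ℝ) / 2 ^ 21 ≤ P.L := div_le_self (by linarith) (one_le_pow₀ (by norm_num))
    linarith
  -- exponentiate
  unfold δR
  have h6 : (0 : ℝ) < 6 * P.Nh lev := by linarith
  have hprod : ((P.LbRK κ lev P.jl : ℝ) + 1) * (6 * (P.Nh lev : ℝ)) ≤ Real.exp (P.U0 c) := by
    have := Real.exp_le_exp.mpr hbud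
    rwa [Real.exp_add, Real.exp_log (by linarith), Real.exp_log h6] at this
  have hexp : 0 < Real.exp (-P.U0 c) := Real.exp_pos _
  calc (P.LbRK κ lev P.jl : ℝ) * Real.exp (-P.U0 c) * (6 * P.Nh lev)
      ≤ ((P.LbRK κ lev P.jl : ℝ) + 1) * (6 * (P.Nh lev : ℝ)) * Real.exp (-P.U0 c) := by nlinarith
    _ ≤ Real.exp (P.U0 c) * Real.exp (-P.U0 c) := mul_le_mul_of_nonneg_right hprod hexp.le
    _ = 1 := by rw [← Real.exp_add, add_neg_cancel, Real.exp_zero]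

/-- **THE COEFFICIENT LINE (C) of the O-family** (`1 ≤ lev ≤ Ŝ`, `κ ≥ 1` with `log κ ≤ n log 2`, e.g. `κ = 2^(n−1)`; the global `cPRK` through
the shared hypothesis `cPRK κ ≤ cPz·Z`, `cPz ≤ 9/4`; the budget `2^{4n}·Z ≤ U0 c`, i.e. p4's `U0_ge 4`, `c ≥ 2^64`):
`cUR + cPRK + log DΔC + log WC + (γb+wl)·Nf + cbRK + cDR + log 3 < 0` — total cost `≤ 5.75·Z < 256·Z ≤ U0 c`.
[cite: Nesterenko2003, §4.2 (4.30)–(4.35); shape only] -/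
theorem oddC_holds (hn : 2 ≤ n) {κ : ℕ} (hκ : 1 ≤ κ) (hlκ : Real.log κ ≤ n * Real.log 2) {c cPz : ℝ}
    (hcP : P.cPRK κ ≤ cPz * P.Z) (hcPz : cPz ≤ 9 / 4) (hU0 : (2 : ℝ) ^ (4 * n) * P.Z ≤ P.U0 c)
    (lev : ℕ) (hlev : 1 ≤ lev) (hlevS : lev ≤ P.Sd) :
    ∀ (x₁ : ℤ) (a : ℕ), |x₁| ≤ (P.Nf lev 1 : ℤ) → a < P.Tf lev 1 →
      P.cUR + P.cPRK κ + Real.log (DΔC (P.YRK κ lev) (P.Tf lev 1)) + Real.log (WC P.H (P.Sd - lev) P.L₀ (P.Tf lev 0) (6 * P.Nh lev)) +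
        (P.γb lev + P.wl lev) * P.Nf lev 1 + P.cbRK κ c lev (P.Nf lev 1) + P.cDR lev a |(x₁ : ℝ)| + Real.log 3 < 0 := by
  intro x₁ a hx ha
  obtain ⟨hZ, -, hXL, -, -, hG⟩ := P.currenciesO hn
  obtain ⟨hLZ, hXLZ, hXZ, hLWZ, hWNZ, hZ1⟩ := P.currenciesO' hn
  obtain ⟨hc1, hc2, hl3, hl2, h256⟩ := P.constsO hn
  obtain ⟨hNh1, hNh, hNf, -⟩ := P.Nh_realO lev
  obtain ⟨hwl0, hγ0, hγNh, hwNh⟩ := P.weights_Nh_leO lev hlev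
  obtain ⟨hyB1, hlyB⟩ := yB_factsO (n := n) hn hκ hlκ
  obtain ⟨hY0, hY⟩ := P.YRK_le κ hκ lev
  -- the atoms
  have hA1 := (P.cUR_le_ZO hn).1
  have hA2 : P.cPRK κ ≤ 9 / 4 * P.Z := hcP.trans (by nlinarith only [hcPz, hZ])
  have hA3 : Real.log (DΔC (P.YRK κ lev) (P.Tf lev 1)) ≤ P.Z :=
    P.log_DΔC_le_ZO hn hyB1 hlyB hY0 (by linarith only [hY]) lev 1
  have hA4 : Real.log (WC P.H (P.Sd - lev) P.L₀ (P.Tf lev 0) (6 * P.Nh lev)) ≤ 3 / 2 * P.Z :=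
    P.log_WC_le_ZO hn (Nat.sub_le _ _) (P.Tf_le_Tf00 lev 0) (by positivity) (P.odd_radius_leO lev hlevS)
  have hA5 : (P.γb lev + P.wl lev) * (P.Nf lev 1 : ℝ) ≤ 4 * (P.Z / 24) := by
    rw [hNf]; nlinarith only [hγNh, hwNh, hXLZ]
  have hA6 : P.cbRK κ c lev (P.Nf lev 1) ≤ P.Z / 10 - P.U0 c := P.cb_parts_le_ZO hn κ lev hlevS (le_of_eq hNf) c
  have hxr : |(x₁ : ℝ)| ≤ 2 * P.Nh lev := by
    have : ((|x₁| : ℤ) : ℝ) ≤ ((P.Nf lev 1 : ℕ) : ℤ) := by exact_mod_cast hx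
    rw [Int.cast_abs] at this; push_cast at this; linarith only [this, hNf]
  have hA7 : P.cDR lev a |(x₁ : ℝ)| ≤ 7 / 10 * P.Z :=
    P.cDR_le_ZO hn lev (ha.le.trans (P.Tf_le_Tf00 lev 1)) hxr
  -- the budget
  have hU : 256 * P.Z ≤ P.U0 c := le_trans (by nlinarith only [h256, hZ]) hU0
  linarith only [hA1, hA2, hA3, hA4, hA5, hA6, hA7, hl3, hU, hc2, hZ]

/-- **THE JETS LINE (J) of the O-family** (sorted weights; `1 ≤ lev ≤ Ŝ`, `κ ≥ 1` with `log κ ≤ n log 2`; `cPRK κ ≤ cPz·Z`, `cPz ≤ 9/4`;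
budget `2^{4n}·Z ≤ U0 c`): the first inequality of `OddStepLinesK κ c lev` after the side conditions and the smallness — total cost `≤ 8.8·Z`.
[cite: Nesterenko2003, §4.2 (4.24)–(4.29) with the odd nodes 𝒳_{s,0}; shape only] -/
theorem oddJ_holds (hn : 2 ≤ n) (hmono : Monotone P.A) {κ : ℕ} (hκ : 1 ≤ κ) (hlκ : Real.log κ ≤ n * Real.log 2) {c cPz : ℝ}
    (hcP : P.cPRK κ ≤ cPz * P.Z) (hcPz : cPz ≤ 9 / 4) (hU0 : (2 : ℝ) ^ (4 * n) * P.Z ≤ P.U0 c)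
    (lev : ℕ) (hlev : 1 ≤ lev) (hlevS : lev ≤ P.Sd) :
    ∀ (x₁ : ℤ) (a : ℕ), |x₁| ≤ (P.Nf lev 1 : ℤ) → a < P.Tf lev 1 →
      P.γb lev * P.Nf lev 1 +
        Real.log (2 * ((2 * P.Nh lev : ℕ) : ℝ) ^ (P.T lev + 1) * P.T lev * (20 * Real.exp 1) ^ ((2 * P.Nh lev) * P.T lev)) +
        P.T lev * Real.log 2 + P.T lev * Real.log (2 * P.CRK κ lev) + P.γb lev * (2 * P.Nh lev) + a * Real.log 2 + P.T lev + P.cUR +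
        P.cPRK κ + Real.log (DΔC (P.YRK κ lev) (P.Tf lev 1)) + Real.log (WC P.H (P.Sd - lev) P.L₀ (P.Tf lev 0) (6 * P.Nh lev)) +
        (P.γb lev + P.wl lev) * ((2 * P.Nh lev - 1 : ℕ) : ℝ) + P.cbRK κ c lev (2 * P.Nh lev - 1) + P.cDR lev a |(x₁ : ℝ)| +
        Real.log 3 ≤ 0 := by
  intro x₁ a hx ha
  obtain ⟨hZ, -, hXL, -, -, hG⟩ := P.currenciesO hn
  obtain ⟨hLZ, hXLZ, hXZ, hLWZ, hWNZ, hZ1⟩ := P.currenciesO' hn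
  obtain ⟨hc1, hc2, hl3, hl2, h256⟩ := P.constsO hn
  obtain ⟨-, -, -, -, hTfZ, hT00⟩ := P.letters_ZO hn
  obtain ⟨hNh1, hNh, hNf, -⟩ := P.Nh_realO lev
  obtain ⟨hT1, hT8, -⟩ := P.T_realO lev
  obtain ⟨hwl0, hγ0, hγNh, hwNh⟩ := P.weights_Nh_leO lev hlev
  obtain ⟨hyB1, hlyB⟩ := yB_factsO (n := n) hn hκ hlκ
  obtain ⟨hY0, hY⟩ := P.YRK_le κ hκ lev
  -- the atoms
  have hB1 : P.γb lev * (P.Nf lev 1 : ℝ) ≤ 2 * (P.Z / 24) := by rw [hNf]; nlinarith only [hγNh, hXLZ]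
  have hB2 := P.dirbox_le_ZO hn lev hlevS
  have hB3 : (P.T lev : ℝ) * Real.log 2 ≤ 8 * (P.Z / 4608) := by nlinarith only [hT1, hT8, hl2, hLZ]
  have hB4 := P.T_log_CRK_le_ZO hn hκ hlκ hmono lev hlevS
  have hB5 : P.γb lev * (2 * (P.Nh lev : ℝ)) ≤ 2 * (P.Z / 24) := by nlinarith only [hγNh, hXLZ]
  have hB6 : (a : ℝ) * Real.log 2 ≤ P.Z / 93 := by
    have ha' : (a : ℝ) ≤ P.Tf 0 0 := by exact_mod_cast ha.le.trans (P.Tf_le_Tf00 lev 1)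
    have ha0 : (0 : ℝ) ≤ a := Nat.cast_nonneg _
    nlinarith only [ha', ha0, hl2, hTfZ]
  have hB7 : (P.T lev : ℝ) ≤ 8 * (P.Z / 4608) := by linarith only [hT8, hLZ]
  have hA1 := (P.cUR_le_ZO hn).1
  have hA2 : P.cPRK κ ≤ 9 / 4 * P.Z := hcP.trans (by nlinarith only [hcPz, hZ])
  have hA3 : Real.log (DΔC (P.YRK κ lev) (P.Tf lev 1)) ≤ P.Z :=
    P.log_DΔC_le_ZO hn hyB1 hlyB hY0 (by linarith only [hY]) lev 1
  have hA4 : Real.log (WC P.H (P.Sd - lev) P.L₀ (P.Tf lev 0) (6 * P.Nh lev)) ≤ 3 / 2 * P.Z :=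
    P.log_WC_le_ZO hn (Nat.sub_le _ _) (P.Tf_le_Tf00 lev 0) (by positivity) (P.odd_radius_leO lev hlevS)
  have hm : ((2 * P.Nh lev - 1 : ℕ) : ℝ) ≤ 2 * P.Nh lev := by
    have : 2 * P.Nh lev - 1 ≤ 2 * P.Nh lev := Nat.sub_le _ _
    have h' : ((2 * P.Nh lev - 1 : ℕ) : ℝ) ≤ ((2 * P.Nh lev : ℕ) : ℝ) := by exact_mod_cast this
    push_cast at h'; exact h'
  have hA5 : (P.γb lev + P.wl lev) * ((2 * P.Nh lev - 1 : ℕ) : ℝ) ≤ 4 * (P.Z / 24) := by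
    have h0 : 0 ≤ P.γb lev + P.wl lev := by linarith only [hwl0, hγ0]
    have := mul_le_mul_of_nonneg_left hm h0
    nlinarith only [this, hγNh, hwNh, hXLZ]
  have hA6 : P.cbRK κ c lev (2 * P.Nh lev - 1) ≤ P.Z / 10 - P.U0 c := P.cb_parts_le_ZO hn κ lev hlevS hm c
  have hxr : |(x₁ : ℝ)| ≤ 2 * P.Nh lev := by
    have : ((|x₁| : ℤ) : ℝ) ≤ ((P.Nf lev 1 : ℕ) : ℤ) := by exact_mod_cast hx
    rw [Int.cast_abs] at this; push_cast at this; linarith only [this, hNf]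
  have hA7 : P.cDR lev a |(x₁ : ℝ)| ≤ 7 / 10 * P.Z :=
    P.cDR_le_ZO hn lev (ha.le.trans (P.Tf_le_Tf00 lev 1)) hxr
  -- the budget
  have hU : 256 * P.Z ≤ P.U0 c := le_trans (by nlinarith only [h256, hZ]) hU0
  linarith only [hB1, hB2, hB3, hB4, hB5, hB6, hB7, hA1, hA2, hA3, hA4, hA5, hA6, hA7, hl3, hU, hc2, hZ]

end ArchG3Rec

end Summit.ABC.StewartYu

end
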